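import Literature.NumberTheory.Sieve.SmoothNumbersLowerBoundLHalf
import Mathlib.Analysis.SpecialFunctions.Pow.Asymptotics
import HarnessLib

/-!
# De Bruijn's "almost trivial" lower bound `ψ(x, logᵏ x) ≥ x^{1 - 1/κ - ε}`

Topic `NumberTheory/Sieve` (smooth numbers), in the vocabulary of
`SmoothNumbersRestrictedPrimes.lean` / `SmoothNumbersLowerBoundLHalf.lean`:
`ψ(x, y) = #(factoredUpTo (Nat.primesLE y) x)` is the number of integers `1 ≤ n ≤ x` all of whose
prime factors are `≤ y` (`= #(Nat.smoothNumbersUpTo x (y + 1))`,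
`factoredUpTo_primesLE_eq_smoothNumbersUpTo`). The companion file treats the `L[1/2]` range
`y = exp(β √(log x log log x))`; this file treats the much sparser POLYLOGARITHMIC range
`y = (log x)^κ`, `κ > 1` fixed, where `ψ(x, logᵏ x) = x^{1 - 1/κ + o(1)}` (`x → ∞`), and PROVES
THE LOWER HALF:

* `card_factoredUpTo_polylog_ge` — for `κ > 1`, `ε > 0` and all large `x : ℕ`,
  `x^{1 - 1/κ - ε} ≤ ψ(x, ⌊(log x)^κ⌋)`; `card_smoothNumbersUpTo_polylog_ge` — the same for
  Mathlib's `Nat.smoothNumbersUpTo x (⌊(log x)^κ⌋ + 1)`.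

Proof (de Bruijn's counting): with `w = ⌊logᵏ x⌋`, `m = π(w)` and `u = ⌊log x / (κ log log x)⌋`
one has `w^u ≤ x`, so the products of `u` primes `≤ w` (with repetition) are `#((primesLE w).sym u)
≥ m^u / u! ≥ (m/u)^u` distinct numbers counted by `ψ(x, w)` (the tree's
`card_sym_le_card_factoredUpTo_of_pow_le`, `card_pow_le_factorial_mul_card_sym`); Chebyshev
(`div_four_mul_log_le_primeCounting`) gives `m ≥ w/(4 log w) ≥ logᵏ x / (8 κ log log x)`, so
`m/u ≥ (log x)^{κ-1}/8` and
`log ψ ≥ u ((κ - 1) log log x - log 8) ≥ (log x/(κ log log x) - 1)((κ - 1) log log x - log 8)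
 ≥ (1 - 1/κ) log x - (log 8/(κ log log x)) log x - (κ - 1) log log x ≥ (1 - 1/κ - ε) log x`.

This is the estimate "`Ψ(x, log^K x) = x^{1-1/K+o(1)}` … (which can actually be proved more
simply)" quoted in [Harper2016, §2.1, footnote 3] from Hildebrand–Tenenbaum; the counting is
de Bruijn's (Indag. Math. 28 (1966), §2), as in `Literature/NumberTheory/Primality/SmoothNumbersLowerBound.lean`
(a cruder explicit form, exponent `1/2`). NOT here: the upper half `ψ(x, logᵏ x) ≤ x^{1 - 1/κ + ε}`
(Rankin's method, cf. `RankinSmoothBound.lean`) and any saddle-point asymptotics.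

## References

* [Harper2016] A. J. Harper, Compositio Math. 152 (2016) 1121–1158, §2.1 (footnote:
  `Ψ(x, log^K x) = x^{1-1/K+o(1)}`), arXiv:1408.1662.
* N. G. de Bruijn, *On the number of positive integers `≤ x` and free of prime factors `> y`. II*,
  Indag. Math. 28 (1966) 239–247, §2 (the counting idea; proved here from scratch).
* [LenstraPomerance1992] H. W. Lenstra Jr., C. Pomerance, J. Amer. Math. Soc. 5 (1992), §6 (the
  vocabulary `ψ(x; Q)` and the multiset counting reused here).
-/

noncomputable section

open Real Filter Finset

namespace Literature.NumberTheory.Sieve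

/-! ### De Bruijn's counting in real form -/

/-- **De Bruijn's counting, real form.** If all primes `≤ w` number `m = π(w)` and `w^u ≤ x` with
`1 ≤ u ≤ m`… in fact for any `u ≥ 1`: `(m/u)^u ≤ ψ(x, w)` — the products of `u` primes `≤ w`, with
repetition, are `#((primesLE w).sym u) ≥ m^u/u! ≥ (m/u)^u` distinct `w`-smooth integers `≤ x`.
[folklore] -/
theorem div_pow_le_card_factoredUpTo {w u x : ℕ} (hu : 0 < u) (hwx : w ^ u ≤ x) :
    ((Nat.primeCounting w : ℝ) / u) ^ u ≤ #(factoredUpTo (Nat.primesLE w) x) := by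
  have hR : ∀ p ∈ Nat.primesLE w, p.Prime := fun p hp => Nat.prime_of_mem_primesLE hp
  have hRw : ∀ p ∈ Nat.primesLE w, p ≤ w := fun p hp => Nat.le_of_mem_primesLE hp
  have h1 := card_sym_le_card_factoredUpTo_of_pow_le hR hRw hwx
  have h2 := card_pow_le_factorial_mul_card_sym (Nat.primesLE w) u
  rw [Nat.primesLE_card_eq_primeCounting] at h2
  have hu0 : (0 : ℝ) < u := by exact_mod_cast hu
  have hfact : (u.factorial : ℝ) ≤ (u : ℝ) ^ u := by exact_mod_cast Nat.factorial_le_pow u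
  have hfact0 : (0 : ℝ) < u.factorial := by exact_mod_cast u.factorial_pos
  rw [div_pow, div_le_iff₀ (pow_pos hu0 u)]
  calc (Nat.primeCounting w : ℝ) ^ u ≤ u.factorial * #((Nat.primesLE w).sym u) := h2
    _ ≤ u.factorial * #(factoredUpTo (Nat.primesLE w) x) := by gcongr
    _ ≤ (u : ℝ) ^ u * #(factoredUpTo (Nat.primesLE w) x) := by gcongr
    _ = _ := mul_comm _ _

/-! ### The lower bound `ψ(x, logᵏ x) ≥ x^{1 - 1/κ - ε}` -/

/-- **De Bruijn's almost trivial lower bound in the polylogarithmic range**: for `κ > 1` and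
`ε > 0`, for all sufficiently large `x`, `x^{1 - 1/κ - ε} ≤ ψ(x, ⌊(log x)^κ⌋)` — at least
`x^{1 - 1/κ - ε}` integers `1 ≤ n ≤ x` have all their prime factors `≤ (log x)^κ` (the lower half of
`ψ(x, logᵏ x) = x^{1 - 1/κ + o(1)}`). Proof in the module docstring.
[cite: Harper2016, §2.1 (footnote: Ψ(x, log^K x) = x^{1-1/K+o(1)}, "can be proved more simply")] -/
theorem card_factoredUpTo_polylog_ge {κ ε : ℝ} (hκ : 1 < κ) (hε : 0 < ε) :
    ∀ᶠ x : ℕ in atTop,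
      (x : ℝ) ^ (1 - 1 / κ - ε) ≤ #(factoredUpTo (Nat.primesLE ⌊Real.log x ^ κ⌋₊) x) := by
  have hκ0 : 0 < κ := one_pos.trans hκ
  have hκ1 : 0 < κ - 1 := sub_pos.mpr hκ
  have hlog8 : 0 < Real.log 8 := Real.log_pos (by norm_num)
  -- tendsto facts
  have Tℓ : Tendsto (fun x : ℕ => Real.log x) atTop atTop :=
    Real.tendsto_log_atTop.comp tendsto_natCast_atTop_atTop
  have Tℓ₂ : Tendsto (fun x : ℕ => Real.log (Real.log x)) atTop atTop :=
    Real.tendsto_log_atTop.comp Tℓ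
  -- `log log x ≤ c log x` eventually, for every `c > 0`
  have hsmall : ∀ c : ℝ, 0 < c → ∀ᶠ x : ℕ in atTop, Real.log (Real.log x) ≤ c * Real.log x := by
    intro c hc
    have h := (Real.isLittleO_log_id_atTop.comp_tendsto Tℓ).bound hc
    filter_upwards [h, Tℓ.eventually_ge_atTop 0] with x hx hℓ0
    simp only [Function.comp_apply, id_eq, Real.norm_eq_abs] at hx
    rw [abs_of_nonneg hℓ0] at hx
    exact (le_abs_self _).trans hx
  have E0 : ∀ᶠ x : ℕ in atTop, (1 : ℝ) ≤ x := tendsto_natCast_atTop_atTop.eventually_ge_atTop 1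
  have E1 : ∀ᶠ x : ℕ in atTop, (1 : ℝ) ≤ Real.log x := Tℓ.eventually_ge_atTop 1
  have E2 : ∀ᶠ x : ℕ in atTop, (1 : ℝ) ≤ Real.log (Real.log x) := Tℓ₂.eventually_ge_atTop 1
  have E3 : ∀ᶠ x : ℕ in atTop, (4 : ℝ) ≤ Real.log x ^ κ :=
    ((tendsto_rpow_atTop hκ0).comp Tℓ).eventually_ge_atTop 4
  have E4 : ∀ᶠ x : ℕ in atTop, (8 : ℝ) ≤ Real.log x ^ (κ - 1) :=
    ((tendsto_rpow_atTop hκ1).comp Tℓ).eventually_ge_atTop 8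
  have E5 : ∀ᶠ x : ℕ in atTop, Real.log 8 / (κ - 1) ≤ Real.log (Real.log x) :=
    Tℓ₂.eventually_ge_atTop _
  have E6 : ∀ᶠ x : ℕ in atTop, 2 * Real.log 8 / (κ * ε) ≤ Real.log (Real.log x) :=
    Tℓ₂.eventually_ge_atTop _
  have E7 := hsmall (ε / (2 * (κ - 1))) (by positivity)
  have E8 := hsmall (1 / (2 * κ)) (by positivity)
  filter_upwards [E0, E1, E2, E3, E4, E5, E6, E7, E8] with x h0 h1 h2 h3 h4 h5 h6 h7 h8
  -- notation: `ℓ = log x`, `ℓ₂ = log log x`, `y = ℓ^κ`, `w = ⌊y⌋`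
  set ℓ : ℝ := Real.log x with hℓ
  set ℓ₂ : ℝ := Real.log ℓ with hℓ₂
  have hx0 : (0 : ℝ) < x := one_pos.trans_le h0
  have hℓ0 : 0 < ℓ := one_pos.trans_le h1
  have hℓ₂0 : 0 < ℓ₂ := one_pos.trans_le h2
  set y : ℝ := ℓ ^ κ with hy
  have hy0 : 0 ≤ y := Real.rpow_nonneg hℓ0.le κ
  have hlogy : Real.log y = κ * ℓ₂ := by rw [hy, Real.log_rpow hℓ0]
  set w : ℕ := ⌊y⌋₊ with hw
  -- the parameter `u = ⌊ℓ / (κ ℓ₂)⌋`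
  set r : ℝ := ℓ / (κ * ℓ₂) with hr
  have hκℓ₂ : 0 < κ * ℓ₂ := mul_pos hκ0 hℓ₂0
  have hr2 : 2 ≤ r := by
    rw [hr, le_div_iff₀ hκℓ₂]
    have h8' := h8
    rw [div_mul_eq_mul_div, one_mul, le_div_iff₀ (by positivity)] at h8'
    linarith
  have hr0 : 0 ≤ r := zero_le_two.trans hr2
  set u : ℕ := ⌊r⌋₊ with hu
  have hur : (u : ℝ) ≤ r := Nat.floor_le hr0
  have hru : r - 1 ≤ u := by have := Nat.lt_floor_add_one r; linarith
  have hu1 : 1 ≤ u := Nat.le_floor (by norm_num; linarith)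
  have hu0 : (0 : ℝ) < u := by exact_mod_cast hu1
  -- `m = π(w) ≥ y / (8 κ ℓ₂)`
  set m : ℕ := Nat.primeCounting w with hm
  have hw4 : 4 ≤ w := Nat.le_floor (by exact_mod_cast h3)
  have hw0 : (0 : ℝ) < w := by exact_mod_cast (show 0 < w by omega)
  have hmy : y ≤ 8 * κ * ℓ₂ * m := by
    have hπ := div_four_mul_log_le_primeCounting hw4
    have hlogw0 : 0 < Real.log w := Real.log_pos (by exact_mod_cast (show 1 < w by omega))
    rw [← hm, div_le_iff₀ (by positivity)] at hπ
    -- `w ≤ 4 m log w ≤ 4 m log y = 4 m κ ℓ₂` and `y < w + 1 ≤ 2 w`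
    have hlogle : Real.log w ≤ κ * ℓ₂ := hlogy ▸ Real.log_le_log hw0 (Nat.floor_le hy0)
    have hm0 : (0 : ℝ) ≤ m := Nat.cast_nonneg _
    have hylt : y < w + 1 := Nat.lt_floor_add_one y
    nlinarith [mul_le_mul_of_nonneg_left hlogle (by positivity : (0 : ℝ) ≤ 4 * m)]
  -- `m / u ≥ ℓ^{κ-1} / 8`
  have hysplit : y = ℓ ^ (κ - 1) * ℓ := by
    rw [hy, Real.rpow_sub_one hℓ0.ne', div_mul_cancel₀ _ hℓ0.ne']
  have hmu : ℓ ^ (κ - 1) / 8 * u ≤ m := by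
    have h1' : ℓ ^ (κ - 1) / 8 * u ≤ ℓ ^ (κ - 1) / 8 * r :=
      mul_le_mul_of_nonneg_left hur (by positivity)
    have h2' : ℓ ^ (κ - 1) / 8 * r = y / (8 * κ * ℓ₂) := by
      rw [hysplit, hr]; field_simp
    have h3' : y / (8 * κ * ℓ₂) ≤ m := by
      rw [div_le_iff₀ (by positivity)]; linarith
    linarith
  have hquot : ℓ ^ (κ - 1) / 8 ≤ (m : ℝ) / u := by
    rw [le_div_iff₀ hu0]; exact hmu
  -- `w^u ≤ y^u = ℓ^{κ u} ≤ ℓ^{ℓ/ℓ₂} = x`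
  have hpow : y ^ u ≤ x := by
    have hyu : y ^ u = ℓ ^ (κ * u) := by
      rw [hy, ← Real.rpow_natCast, ← Real.rpow_mul hℓ0.le]
    have hκu : κ * u ≤ ℓ / ℓ₂ := by
      calc κ * u ≤ κ * r := mul_le_mul_of_nonneg_left hur hκ0.le
        _ = ℓ / ℓ₂ := by rw [hr]; field_simp
    calc y ^ u = ℓ ^ (κ * u) := hyu
      _ ≤ ℓ ^ (ℓ / ℓ₂) := Real.rpow_le_rpow_of_exponent_le h1 hκu
      _ = Real.exp ℓ := by
          rw [Real.rpow_def_of_pos hℓ0, ← hℓ₂]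
          congr 1
          field_simp
      _ = x := by rw [hℓ, Real.exp_log hx0]
  have hwx : w ^ u ≤ x := by
    have h : ((w ^ u : ℕ) : ℝ) ≤ x := by
      calc ((w ^ u : ℕ) : ℝ) = (w : ℝ) ^ u := by push_cast; rfl
        _ ≤ y ^ u := pow_le_pow_left₀ hw0.le (Nat.floor_le hy0) u
        _ ≤ x := hpow
    exact_mod_cast h
  -- the count: `ψ ≥ (m/u)^u ≥ (ℓ^{κ-1}/8)^u`
  have hcount := div_pow_le_card_factoredUpTo (x := x) hu1 hwx
  rw [← hm] at hcount
  have hW0 : 0 < ℓ ^ (κ - 1) / 8 := by positivity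
  refine le_trans ?_ ((pow_le_pow_left₀ hW0.le hquot u).trans hcount)
  -- exponent bookkeeping: `(1 - 1/κ - ε) ℓ ≤ u ((κ-1) ℓ₂ - log 8)`
  have hD : Real.log (ℓ ^ (κ - 1) / 8) = (κ - 1) * ℓ₂ - Real.log 8 := by
    rw [Real.log_div (by positivity) (by norm_num), Real.log_rpow hℓ0]
  have hD0 : 0 ≤ (κ - 1) * ℓ₂ - Real.log 8 := by
    have : Real.log 8 ≤ (κ - 1) * ℓ₂ := by
      rw [div_le_iff₀ hκ1] at h5; linarith
    linarith
  have hkey : (1 - 1 / κ - ε) * ℓ ≤ u * ((κ - 1) * ℓ₂ - Real.log 8) := by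
    -- `u D ≥ (r - 1) D = (1 - 1/κ) ℓ - (log 8 / (κ ℓ₂)) ℓ - D`, `D ≤ (κ-1) ℓ₂ ≤ ε ℓ / 2`,
    -- `(log 8 / (κ ℓ₂)) ℓ ≤ ε ℓ / 2`
    have hstep1 : (r - 1) * ((κ - 1) * ℓ₂ - Real.log 8) ≤ u * ((κ - 1) * ℓ₂ - Real.log 8) :=
      mul_le_mul_of_nonneg_right hru hD0
    have hrD : r * ((κ - 1) * ℓ₂ - Real.log 8) =
        (1 - 1 / κ) * ℓ - Real.log 8 / (κ * ℓ₂) * ℓ := by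
      rw [hr]; field_simp
    have hA : Real.log 8 / (κ * ℓ₂) * ℓ ≤ ε / 2 * ℓ := by
      refine mul_le_mul_of_nonneg_right ?_ hℓ0.le
      rw [div_le_iff₀ hκℓ₂]
      rw [div_le_iff₀ (by positivity)] at h6
      linarith
    have hB : (κ - 1) * ℓ₂ - Real.log 8 ≤ ε / 2 * ℓ := by
      have : (κ - 1) * ℓ₂ ≤ ε / 2 * ℓ := by
        have h7' := mul_le_mul_of_nonneg_left h7 hκ1.le
        have : (κ - 1) * (ε / (2 * (κ - 1)) * ℓ) = ε / 2 * ℓ := by field_simp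
        linarith
      linarith
    nlinarith
  have hlhs : (x : ℝ) ^ (1 - 1 / κ - ε) = Real.exp ((1 - 1 / κ - ε) * ℓ) := by
    rw [Real.rpow_def_of_pos hx0, hℓ, mul_comm]
  have hrhs : (ℓ ^ (κ - 1) / 8) ^ u = Real.exp (u * ((κ - 1) * ℓ₂ - Real.log 8)) := by
    rw [← hD, ← Real.log_pow, Real.exp_log (pow_pos hW0 u)]
  rw [hlhs, hrhs, Real.exp_le_exp]
  exact hkey

/-- `card_factoredUpTo_polylog_ge` for Mathlib's smooth numbers: for `κ > 1`, `ε > 0` and all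
large `x`, `x^{1 - 1/κ - ε} ≤ #(Nat.smoothNumbersUpTo x (⌊(log x)^κ⌋ + 1))`.
[cite: Harper2016, §2.1 (footnote: Ψ(x, log^K x) = x^{1-1/K+o(1)})] -/
theorem card_smoothNumbersUpTo_polylog_ge {κ ε : ℝ} (hκ : 1 < κ) (hε : 0 < ε) :
    ∀ᶠ x : ℕ in atTop,
      (x : ℝ) ^ (1 - 1 / κ - ε) ≤ #(Nat.smoothNumbersUpTo x (⌊Real.log x ^ κ⌋₊ + 1)) := by
  filter_upwards [card_factoredUpTo_polylog_ge hκ hε] with x hx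
  rwa [← factoredUpTo_primesLE_eq_smoothNumbersUpTo]

end Literature.NumberTheory.Sieve

end
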